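import Summits.Ventures.LatticeQCDFlow.Exactness.IMHCommonRandomNumbers
import HarnessLib

/-!
# Common random numbers, exactly: the pair law after `n` shared updates is
# `(1 − rⁿ)·(π on the diagonal) + rⁿ·(residual)` — two runs fed the same random numbers have MERGED with
# probability at least `1 − rⁿ`, from ANY two starts

HONEST FRAMING: exact (Metropolis-corrected) sampling algorithms for lattice gauge theory;
figures of merit are autocorrelation/cost numbers at stated couplings and volumes; no
continuum-physics claim.

Venture `LatticeQCDFlow` (cell pub-lqcd), topic `Exactness`; FANOUT row 30 (lean-1, GEN-36).  NEW WORK of the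
cell, general state space.  `Exactness/IMHCommonRandomNumbers` (this generation) realised the common-random-numbers
coupling of flow-MCMC `K = indepMH q w` (normalised weight `w`, maximal at `x₀`, `A = 1/w(x₀)`, `r = 1 − A`) as a
Markov kernel `K̂` on `Ω × Ω` (any kernel satisfying the defining equation; one exists) minorised by the DIAGONAL
LIFT `π̂ = π∘(y ↦ (y, y))⁻¹` of the target with the exact constant `A`.  Here the any-start machinery of GEN-34
(`Exactness/IMHAnyStartSplit`, Doeblin's split of `Literature/…/DoeblinMinorization`) is run ON THE PAIR CHAIN:

* §1 **`crnPair_minorised`** — `A·π̂(C) ≤ K̂(z, C)` for every pair `z` and measurable `C`;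
  **`bind_diagLift_crnPair`** — `π̂K̂ = π̂`: two merged equilibrium runs stay merged and in equilibrium (THE DIAGONAL
  LIFT OF THE TARGET IS INVARIANT for the pair chain); **`bind_residual_crnPair_diagLift`** — and for its residual
  kernel.
* §2 **`iterate_bind_crnPair_eq_residual_mixture`** — FOR EVERY INITIAL COUPLING `μ̂₀` (any joint law of the two
  starting configurations: two seeds, cold + hot, a run and its restart) and every `n`:
  `μ̂₀K̂ⁿ = (1 − rⁿ)·π̂ + rⁿ·μ̂₀R̂ⁿ` EXACTLY, `R̂` the residual kernel of the pair minorisation — after `n` shared updates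
  the pair IS, with probability `1 − rⁿ`, ONE `π`-distributed configuration recorded twice.
* §3 consequences from every initial coupling: **`iterate_bind_crnPair_real_ge`** — `P(Ẑ_n ∈ C) ≥ (1 − rⁿ)·π{y :
  (y, y) ∈ C}`; **`iterate_bind_crnPair_diagonal_ge`** — under Mathlib's `MeasurableEq Ω` (every Polish configuration
  space): `P(X_n = X′_n) ≥ 1 − rⁿ` — THE TWO RUNS COINCIDE after `n` shared updates except with probability `rⁿ`,
  so `log(1/δ) ≤ n·A` shared updates merge them with probability `≥ 1 − δ`
  (**`iterate_bind_crnPair_diagonal_ge_of_log_le`**); **`iterate_bind_crnPair_observable_eq_ge`** — diagonal-free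
  form: every measurable observable READS THE SAME on the two runs, `P(g(X_n) = g(X′_n)) ≥ 1 − rⁿ`;
  **`integral_iterate_bind_crnPair_abs_sub_le`** — for measurable `a ≤ g ≤ c`:
  `E|g(X_n) − g(X′_n)| ≤ rⁿ·(c − a)` — the common-random-numbers DIFFERENCE of any bounded observable between two
  runs is small in mean, not only in expectation-difference (GEN-35 `IMHTwoStarts` bounded `|E g(X_n) − E g(X′_n)|`
  by the same `rⁿ·(c − a)` for ARBITRARY joint laws; with shared random numbers the random variables themselves agree).
Reading (gauge files `Scaling/AutoregressiveGauge…CommonRandomNumbers`): two exact gauge samplers fed the same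
autoregressive proposals and uniforms from ANY two initial configurations are the same configuration after `n`
updates except with probability `(1 − A)ⁿ`.
NOT CLAIMED: that `rⁿ` is attained for a specific pair of starts (it is, for a modal + atom-free start — not proved
here); the residual pair law in closed form; path-space statements (next file `…CommonRandomNumbersPath`).
No `sorry`, no new definitions, nothing cited as a fact.
-/

noncomputable section

namespace Summit.Ventures.LatticeQCDFlow.Exactness

open MeasureTheory ProbabilityTheory Function Set
open scoped ENNReal unitInterval
open Literature.Probability.MarkovChains

variable {Ω : Type*} [MeasurableSpace Ω] {q : Measure Ω} [IsProbabilityMeasure q] {w : Ω → ℝ}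

/-! ## §1 The pair minorisation and the invariance of the diagonal lift -/

/-- The diagonal lift of a probability law is a probability law. [ours, bookkeeping] -/
theorem isProbabilityMeasure_diagLift (π : Measure Ω) [IsProbabilityMeasure π] :
    IsProbabilityMeasure (π.map (fun y : Ω => (y, y))) :=
  Measure.isProbabilityMeasure_map (measurable_id.prodMk measurable_id).aemeasurable

omit [IsProbabilityMeasure q] in
/-- **THE PAIR MINORISATION**: `A·π̂(C) ≤ K̂(z, C)` for every pair `z` and measurable `C ⊆ Ω × Ω`, `π̂` the diagonal
lift of the target, `A = 1/w(x₀)`. [ours] -/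
theorem crnPair_minorised (hw : Measurable w) (hw0 : ∀ y, 0 < w y) {x₀ : Ω} (hmax : ∀ y, w y ≤ w x₀)
    (Khat : Kernel (Ω × Ω) (Ω × Ω))
    (hK : ∀ z : Ω × Ω, Khat z = (q.prod (volume : Measure unitInterval)).map (fun p : Ω × unitInterval =>
      ((if (p.2 : ℝ) * w z.1 ≤ w p.1 then p.1 else z.1), (if (p.2 : ℝ) * w z.2 ≤ w p.1 then p.1 else z.2)))) :
    ∀ z {C : Set (Ω × Ω)}, MeasurableSet C →
      ENNReal.ofReal (w x₀)⁻¹ * ((q.withDensity fun y => ENNReal.ofReal (w y)).map (fun y : Ω => (y, y))) C ≤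
        Khat z C := by
  intro z C hC
  have hdiag : Measurable (fun y : Ω => (y, y)) := measurable_id.prodMk measurable_id
  rw [Measure.map_apply hdiag hC]
  exact crnPair_ge_diagonal hw hw0 hmax Khat hK z hC

omit [IsProbabilityMeasure q] in
/-- When the mode has weight `1` the pair kernel IS the diagonal lift of the target from every pair (`K̂ ≥ π̂` between
probability laws): two runs of an i.i.d. sampler fed the same random numbers coincide after one update. [ours] -/
theorem crnPair_apply_eq_diagLift_of_mode_eq_one (hw : Measurable w) (hw0 : ∀ y, 0 < w y) {x₀ : Ω}
    (hmax : ∀ y, w y ≤ w x₀) (h1 : w x₀ = 1) [IsProbabilityMeasure (q.withDensity fun y => ENNReal.ofReal (w y))]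
    (Khat : Kernel (Ω × Ω) (Ω × Ω)) [IsMarkovKernel Khat]
    (hK : ∀ z : Ω × Ω, Khat z = (q.prod (volume : Measure unitInterval)).map (fun p : Ω × unitInterval =>
      ((if (p.2 : ℝ) * w z.1 ≤ w p.1 then p.1 else z.1), (if (p.2 : ℝ) * w z.2 ≤ w p.1 then p.1 else z.2))))
    (z : Ω × Ω) : Khat z = (q.withDensity fun y => ENNReal.ofReal (w y)).map (fun y : Ω => (y, y)) := by
  set πh : Measure (Ω × Ω) := (q.withDensity fun y => ENNReal.ofReal (w y)).map (fun y : Ω => (y, y)) with hπh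
  haveI : IsProbabilityMeasure πh := isProbabilityMeasure_diagLift _
  have hge : ∀ {C : Set (Ω × Ω)}, MeasurableSet C → πh C ≤ Khat z C := by
    intro C hC
    have h := crnPair_minorised hw hw0 hmax Khat hK z hC
    rwa [h1, inv_one, ENNReal.ofReal_one, one_mul] at h
  ext C hC
  refine le_antisymm ?_ (hge hC)
  have hKc : Khat z C = 1 - Khat z Cᶜ := by
    rw [← prob_add_prob_compl (μ := Khat z) hC, ENNReal.add_sub_cancel_right (measure_ne_top _ _)]
  have hπc : πh C = 1 - πh Cᶜ := by
    rw [← prob_add_prob_compl (μ := πh) hC, ENNReal.add_sub_cancel_right (measure_ne_top _ _)]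
  rw [hKc, hπc]
  exact tsub_le_tsub_left (hge hC.compl) 1

/-- **THE DIAGONAL LIFT OF THE TARGET IS INVARIANT FOR THE PAIR CHAIN**: `π̂K̂ = π̂` — two runs that have merged and
are in equilibrium stay merged and in equilibrium. [ours] -/
theorem bind_diagLift_crnPair (hw : Measurable w) (hw0 : ∀ y, 0 < w y) (Khat : Kernel (Ω × Ω) (Ω × Ω))
    (hK : ∀ z : Ω × Ω, Khat z = (q.prod (volume : Measure unitInterval)).map (fun p : Ω × unitInterval =>
      ((if (p.2 : ℝ) * w z.1 ≤ w p.1 then p.1 else z.1), (if (p.2 : ℝ) * w z.2 ≤ w p.1 then p.1 else z.2)))) :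
    ((q.withDensity fun y => ENNReal.ofReal (w y)).map (fun y : Ω => (y, y))).bind Khat =
      (q.withDensity fun y => ENNReal.ofReal (w y)).map (fun y : Ω => (y, y)) := by
  haveI : Fact (Measurable w) := ⟨hw⟩
  set π : Measure Ω := q.withDensity fun y => ENNReal.ofReal (w y) with hπ
  have hdiag : Measurable (fun y : Ω => (y, y)) := measurable_id.prodMk measurable_id
  have hinv : π.bind (indepMH q w) = π := (indepMH_invariant (q := q) hw hw0).def
  ext C hC
  rw [Measure.bind_apply hC (Kernel.aemeasurable _), lintegral_map (Kernel.measurable_coe Khat hC) hdiag,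
    Measure.map_apply hdiag hC]
  conv_rhs => rw [← hinv, Measure.bind_apply (hdiag hC) (Kernel.aemeasurable _)]
  refine lintegral_congr fun y => ?_
  rw [crnPair_diag_apply hw hw0 Khat hK y, Measure.map_apply hdiag hC]

/-! ## §2 The exact split of the pair law from every initial coupling -/

/-- **EVERY INITIAL COUPLING, EXACTLY.**  `w` measurable, positive, normalised, maximal at `x₀` with `w(x₀) > 1`;
`r = 1 − 1/w(x₀)`; `K̂` a CRN pair kernel (Markov), `R̂` the residual kernel of the pair minorisation
`K̂ ≥ (1/w(x₀))·π̂`.  For every probability law `μ̂₀` on `Ω × Ω` and every `n`: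
`μ̂₀K̂ⁿ = (1 − rⁿ)·π̂ + rⁿ·μ̂₀R̂ⁿ`. [ours] -/
theorem iterate_bind_crnPair_eq_residual_mixture (hw : Measurable w) (hw0 : ∀ y, 0 < w y) {x₀ : Ω}
    (hmax : ∀ y, w y ≤ w x₀) (hlt : 1 < w x₀)
    [IsProbabilityMeasure (q.withDensity fun y => ENNReal.ofReal (w y))]
    (Khat : Kernel (Ω × Ω) (Ω × Ω)) [IsMarkovKernel Khat]
    (hK : ∀ z : Ω × Ω, Khat z = (q.prod (volume : Measure unitInterval)).map (fun p : Ω × unitInterval =>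
      ((if (p.2 : ℝ) * w z.1 ≤ w p.1 then p.1 else z.1), (if (p.2 : ℝ) * w z.2 ≤ w p.1 then p.1 else z.2))))
    (n : ℕ) (μ₀ : Measure (Ω × Ω)) [IsProbabilityMeasure μ₀] :
    (fun m : Measure (Ω × Ω) => m.bind Khat)^[n] μ₀ =
      ENNReal.ofReal (1 - (1 - (w x₀)⁻¹) ^ n) •
          (q.withDensity fun y => ENNReal.ofReal (w y)).map (fun y : Ω => (y, y)) +
        ENNReal.ofReal ((1 - (w x₀)⁻¹) ^ n) •
          (fun m : Measure (Ω × Ω) => m.bind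
            (@Doeblin.residualKernel (Ω × Ω) _ Khat _ ((q.withDensity fun y => ENNReal.ofReal (w y)).map
              (fun y : Ω => (y, y))) (isProbabilityMeasure_diagLift _) (ENNReal.ofReal (w x₀)⁻¹)
              (crnPair_minorised hw hw0 hmax Khat hK)))^[n] μ₀ := by
  set π : Measure Ω := q.withDensity fun y => ENNReal.ofReal (w y) with hπ
  haveI hπh : IsProbabilityMeasure (π.map (fun y : Ω => (y, y))) := isProbabilityMeasure_diagLift π
  set ε : ℝ≥0∞ := ENNReal.ofReal (w x₀)⁻¹ with hε
  have hε1 : ε < 1 := ofReal_inv_lt_one_of_one_lt hlt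
  haveI hRm := @Doeblin.isMarkovKernel_residualKernel (Ω × Ω) _ Khat _ (π.map (fun y : Ω => (y, y))) hπh ε
    (crnPair_minorised hw hw0 hmax Khat hK) hε1
  set R := @Doeblin.residualKernel (Ω × Ω) _ Khat _ (π.map (fun y : Ω => (y, y))) hπh ε
    (crnPair_minorised hw hw0 hmax Khat hK) with hR
  have ha0 : 0 ≤ (w x₀)⁻¹ := inv_nonneg.mpr (hw0 x₀).le
  have hr0 : 0 ≤ 1 - (w x₀)⁻¹ := sub_nonneg.2 (inv_le_one_of_one_le₀ hlt.le)
  have hr1 : 1 - (w x₀)⁻¹ ≤ 1 := sub_le_self _ ha0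
  have hinv : (π.map (fun y : Ω => (y, y))).bind Khat = π.map (fun y : Ω => (y, y)) :=
    bind_diagLift_crnPair hw hw0 Khat hK
  induction n generalizing μ₀ with
  | zero => simp
  | succ n ih =>
    haveI : IsProbabilityMeasure ((fun m : Measure (Ω × Ω) => m.bind R)^[n] μ₀) :=
      isProbabilityMeasure_iterate_bind (κ := R) μ₀ n
    rw [Function.iterate_succ_apply', ih μ₀, Summit.Ventures.LatticeQCDFlow.Scoring.bind_add_measure,
      Measure.bind_smul, Measure.bind_smul, hinv,
      Doeblin.bind_eq_add_residual (κ := Khat) (ν := π.map (fun y : Ω => (y, y))) (ε := ε)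
        (hmin := crnPair_minorised hw hw0 hmax Khat hK) hε1 ((fun m : Measure (Ω × Ω) => m.bind R)^[n] μ₀),
      ← Function.iterate_succ_apply' (fun m : Measure (Ω × Ω) => m.bind R) n μ₀, smul_add, smul_smul, smul_smul,
      ← add_assoc, ← add_smul, hε, one_sub_ofReal_inv_eq hw0 x₀, ← ENNReal.ofReal_mul (pow_nonneg hr0 n),
      ← ENNReal.ofReal_mul (pow_nonneg hr0 n),
      ← ENNReal.ofReal_add (sub_nonneg.2 (pow_le_one₀ hr0 hr1)) (mul_nonneg (pow_nonneg hr0 n) ha0)]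
    congr 3
    all_goals ring

/-- The `R̂`-free form (`w(x₀) ≥ 1`): `μ̂₀K̂ⁿ = (1 − rⁿ)·π̂ + rⁿ·ν̂` for SOME probability law `ν̂` on `Ω × Ω`. [ours] -/
theorem exists_iterate_bind_crnPair_eq_mixture (hw : Measurable w) (hw0 : ∀ y, 0 < w y) {x₀ : Ω}
    (hmax : ∀ y, w y ≤ w x₀) [IsProbabilityMeasure (q.withDensity fun y => ENNReal.ofReal (w y))]
    (Khat : Kernel (Ω × Ω) (Ω × Ω)) [IsMarkovKernel Khat]
    (hK : ∀ z : Ω × Ω, Khat z = (q.prod (volume : Measure unitInterval)).map (fun p : Ω × unitInterval =>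
      ((if (p.2 : ℝ) * w z.1 ≤ w p.1 then p.1 else z.1), (if (p.2 : ℝ) * w z.2 ≤ w p.1 then p.1 else z.2))))
    (n : ℕ) (μ₀ : Measure (Ω × Ω)) [IsProbabilityMeasure μ₀] :
    ∃ ν : Measure (Ω × Ω), IsProbabilityMeasure ν ∧
      (fun m : Measure (Ω × Ω) => m.bind Khat)^[n] μ₀ =
        ENNReal.ofReal (1 - (1 - (w x₀)⁻¹) ^ n) •
            (q.withDensity fun y => ENNReal.ofReal (w y)).map (fun y : Ω => (y, y)) +
          ENNReal.ofReal ((1 - (w x₀)⁻¹) ^ n) • ν := by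
  rcases (one_le_of_mode (q := q) hmax).eq_or_lt with h1 | hlt
  · -- `w(x₀) = 1`: `r = 0`; for `n = 0` take `ν = μ₀`, else `μ̂₀K̂ⁿ = π̂`
    set πh : Measure (Ω × Ω) := (q.withDensity fun y => ENNReal.ofReal (w y)).map (fun y : Ω => (y, y)) with hπh
    haveI : IsProbabilityMeasure πh := isProbabilityMeasure_diagLift _
    refine ⟨if n = 0 then μ₀ else πh, by split_ifs <;> infer_instance, ?_⟩
    rcases n with _ | n
    · simp
    · have hstep : ∀ (m : Measure (Ω × Ω)) [IsProbabilityMeasure m], m.bind Khat = πh := by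
        intro m _
        ext C hC
        rw [Measure.bind_apply hC (Kernel.aemeasurable _)]
        simp_rw [crnPair_apply_eq_diagLift_of_mode_eq_one hw hw0 hmax h1.symm Khat hK]
        rw [lintegral_const, measure_univ, mul_one]
      haveI := isProbabilityMeasure_iterate_bind (κ := Khat) μ₀ n
      rw [Function.iterate_succ_apply', hstep, ← h1]
      simp
  · haveI hπh := isProbabilityMeasure_diagLift (q.withDensity fun y => ENNReal.ofReal (w y))
    haveI := @Doeblin.isMarkovKernel_residualKernel (Ω × Ω) _ Khat _ _ hπh (ENNReal.ofReal (w x₀)⁻¹)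
      (crnPair_minorised hw hw0 hmax Khat hK) (ofReal_inv_lt_one_of_one_lt hlt)
    exact ⟨_, isProbabilityMeasure_iterate_bind μ₀ n,
      iterate_bind_crnPair_eq_residual_mixture hw hw0 hmax hlt Khat hK n μ₀⟩

/-! ## §3 Consequences from every initial coupling -/

/-- **THE LOWER ENVELOPE ON PAIRS**: `P(Ẑ_n ∈ C) ≥ (1 − rⁿ)·π{y : (y, y) ∈ C}` for every measurable `C ⊆ Ω × Ω` and
every initial coupling. [ours] -/
theorem iterate_bind_crnPair_real_ge (hw : Measurable w) (hw0 : ∀ y, 0 < w y) {x₀ : Ω} (hmax : ∀ y, w y ≤ w x₀)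
    [IsProbabilityMeasure (q.withDensity fun y => ENNReal.ofReal (w y))]
    (Khat : Kernel (Ω × Ω) (Ω × Ω)) [IsMarkovKernel Khat]
    (hK : ∀ z : Ω × Ω, Khat z = (q.prod (volume : Measure unitInterval)).map (fun p : Ω × unitInterval =>
      ((if (p.2 : ℝ) * w z.1 ≤ w p.1 then p.1 else z.1), (if (p.2 : ℝ) * w z.2 ≤ w p.1 then p.1 else z.2))))
    (n : ℕ) (μ₀ : Measure (Ω × Ω)) [IsProbabilityMeasure μ₀] {C : Set (Ω × Ω)} (hC : MeasurableSet C) :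
    (1 - (1 - (w x₀)⁻¹) ^ n) * ((q.withDensity fun y => ENNReal.ofReal (w y)).real {y | (y, y) ∈ C}) ≤
      ((fun m : Measure (Ω × Ω) => m.bind Khat)^[n] μ₀).real C := by
  obtain ⟨ν, hν, h⟩ := exists_iterate_bind_crnPair_eq_mixture hw hw0 hmax Khat hK n μ₀
  have hdiag : Measurable (fun y : Ω => (y, y)) := measurable_id.prodMk measurable_id
  have hW : 1 ≤ w x₀ := one_le_of_mode (q := q) hmax
  have hr0 : 0 ≤ 1 - (w x₀)⁻¹ := sub_nonneg.2 (inv_le_one_of_one_le₀ hW)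
  have hr1 : 1 - (w x₀)⁻¹ ≤ 1 := sub_le_self _ (inv_nonneg.mpr (hw0 x₀).le)
  have hc0 : 0 ≤ 1 - (1 - (w x₀)⁻¹) ^ n := sub_nonneg.2 (pow_le_one₀ hr0 hr1)
  rw [h]
  simp only [measureReal_def, Measure.add_apply, Measure.smul_apply, smul_eq_mul, Measure.map_apply hdiag hC]
  rw [ENNReal.toReal_add (ENNReal.mul_ne_top ENNReal.ofReal_ne_top (measure_ne_top _ _))
      (ENNReal.mul_ne_top ENNReal.ofReal_ne_top (measure_ne_top _ _)), ENNReal.toReal_mul,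
    ENNReal.toReal_ofReal hc0]
  exact le_add_of_nonneg_right ENNReal.toReal_nonneg

/-- **THE TWO RUNS COINCIDE EXCEPT WITH PROBABILITY `rⁿ`** (`MeasurableEq Ω` — every Polish configuration space):
`P(X_n = X′_n) ≥ 1 − rⁿ` after `n` shared updates, from every initial coupling. [ours] -/
theorem iterate_bind_crnPair_diagonal_ge (hw : Measurable w) (hw0 : ∀ y, 0 < w y) {x₀ : Ω} (hmax : ∀ y, w y ≤ w x₀)
    [IsProbabilityMeasure (q.withDensity fun y => ENNReal.ofReal (w y))]
    [MeasurableEq Ω]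
    (Khat : Kernel (Ω × Ω) (Ω × Ω)) [IsMarkovKernel Khat]
    (hK : ∀ z : Ω × Ω, Khat z = (q.prod (volume : Measure unitInterval)).map (fun p : Ω × unitInterval =>
      ((if (p.2 : ℝ) * w z.1 ≤ w p.1 then p.1 else z.1), (if (p.2 : ℝ) * w z.2 ≤ w p.1 then p.1 else z.2))))
    (n : ℕ) (μ₀ : Measure (Ω × Ω)) [IsProbabilityMeasure μ₀] :
    1 - (1 - (w x₀)⁻¹) ^ n ≤ ((fun m : Measure (Ω × Ω) => m.bind Khat)^[n] μ₀).real (Set.diagonal Ω) := by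
  have h := iterate_bind_crnPair_real_ge hw hw0 hmax Khat hK n μ₀ measurableSet_diagonal
  have hset : {y : Ω | (y, y) ∈ Set.diagonal Ω} = univ := by
    ext y; simp [Set.mem_diagonal_iff]
  rwa [hset, probReal_univ, mul_one] at h

/-- **`log(1/δ) ≤ n·A` SHARED UPDATES MERGE THE TWO RUNS WITH PROBABILITY `≥ 1 − δ`** (`MeasurableEq Ω`). [ours] -/
theorem iterate_bind_crnPair_diagonal_ge_of_log_le (hw : Measurable w) (hw0 : ∀ y, 0 < w y) {x₀ : Ω}
    (hmax : ∀ y, w y ≤ w x₀) [IsProbabilityMeasure (q.withDensity fun y => ENNReal.ofReal (w y))]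
    [MeasurableEq Ω]
    (Khat : Kernel (Ω × Ω) (Ω × Ω)) [IsMarkovKernel Khat]
    (hK : ∀ z : Ω × Ω, Khat z = (q.prod (volume : Measure unitInterval)).map (fun p : Ω × unitInterval =>
      ((if (p.2 : ℝ) * w z.1 ≤ w p.1 then p.1 else z.1), (if (p.2 : ℝ) * w z.2 ≤ w p.1 then p.1 else z.2))))
    (n : ℕ) (μ₀ : Measure (Ω × Ω)) [IsProbabilityMeasure μ₀] {δ : ℝ} (hδ : 0 < δ)
    (hn : Real.log (1 / δ) ≤ n * (w x₀)⁻¹) :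
    1 - δ ≤ ((fun m : Measure (Ω × Ω) => m.bind Khat)^[n] μ₀).real (Set.diagonal Ω) := by
  have h := iterate_bind_crnPair_diagonal_ge hw hw0 hmax Khat hK n μ₀
  have hW : 1 ≤ w x₀ := one_le_of_mode (q := q) hmax
  have ha0 : 0 ≤ (w x₀)⁻¹ := inv_nonneg.mpr (hw0 x₀).le
  have hr0 : 0 ≤ 1 - (w x₀)⁻¹ := sub_nonneg.2 (inv_le_one_of_one_le₀ hW)
  -- `rⁿ ≤ exp(−n·A) ≤ δ`
  have hrn : (1 - (w x₀)⁻¹) ^ n ≤ δ := by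
    calc (1 - (w x₀)⁻¹) ^ n ≤ Real.exp (-(w x₀)⁻¹) ^ n := by
          gcongr
          have := Real.add_one_le_exp (-(w x₀)⁻¹)
          linarith
      _ = Real.exp (-(n * (w x₀)⁻¹)) := by rw [← Real.exp_nat_mul]; ring_nf
      _ ≤ Real.exp (-Real.log (1 / δ)) := Real.exp_le_exp.2 (neg_le_neg hn)
      _ = δ := by rw [Real.exp_neg, Real.exp_log (by positivity), one_div, inv_inv]
  linarith

/-- **EVERY OBSERVABLE READS THE SAME ON THE TWO RUNS** (diagonal-free form, any measurable space): for a measurable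
`g : Ω → ℝ`, `P(g(X_n) = g(X′_n)) ≥ 1 − rⁿ` after `n` shared updates, from every initial coupling. [ours] -/
theorem iterate_bind_crnPair_observable_eq_ge (hw : Measurable w) (hw0 : ∀ y, 0 < w y) {x₀ : Ω}
    (hmax : ∀ y, w y ≤ w x₀) [IsProbabilityMeasure (q.withDensity fun y => ENNReal.ofReal (w y))]
    (Khat : Kernel (Ω × Ω) (Ω × Ω)) [IsMarkovKernel Khat]
    (hK : ∀ z : Ω × Ω, Khat z = (q.prod (volume : Measure unitInterval)).map (fun p : Ω × unitInterval =>
      ((if (p.2 : ℝ) * w z.1 ≤ w p.1 then p.1 else z.1), (if (p.2 : ℝ) * w z.2 ≤ w p.1 then p.1 else z.2))))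
    (n : ℕ) (μ₀ : Measure (Ω × Ω)) [IsProbabilityMeasure μ₀] {g : Ω → ℝ} (hg : Measurable g) :
    1 - (1 - (w x₀)⁻¹) ^ n ≤ ((fun m : Measure (Ω × Ω) => m.bind Khat)^[n] μ₀).real {p : Ω × Ω | g p.1 = g p.2} := by
  have hC : MeasurableSet {p : Ω × Ω | g p.1 = g p.2} :=
    measurableSet_eq_fun (hg.comp measurable_fst) (hg.comp measurable_snd)
  have h := iterate_bind_crnPair_real_ge hw hw0 hmax Khat hK n μ₀ hC
  have hset : {y : Ω | (y, y) ∈ {p : Ω × Ω | g p.1 = g p.2}} = univ := by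
    ext y; simp
  rwa [hset, probReal_univ, mul_one] at h

/-- **THE COMMON-RANDOM-NUMBERS DIFFERENCE OF A BOUNDED OBSERVABLE IS SMALL IN MEAN**: for measurable `a ≤ g ≤ c`,
`E|g(X_n) − g(X′_n)| ≤ rⁿ·(c − a)` after `n` shared updates, from every initial coupling (on the merged part the two
readings are the same random variable). [ours] -/
theorem integral_iterate_bind_crnPair_abs_sub_le (hw : Measurable w) (hw0 : ∀ y, 0 < w y) {x₀ : Ω}
    (hmax : ∀ y, w y ≤ w x₀) [IsProbabilityMeasure (q.withDensity fun y => ENNReal.ofReal (w y))]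
    (Khat : Kernel (Ω × Ω) (Ω × Ω)) [IsMarkovKernel Khat]
    (hK : ∀ z : Ω × Ω, Khat z = (q.prod (volume : Measure unitInterval)).map (fun p : Ω × unitInterval =>
      ((if (p.2 : ℝ) * w z.1 ≤ w p.1 then p.1 else z.1), (if (p.2 : ℝ) * w z.2 ≤ w p.1 then p.1 else z.2))))
    (n : ℕ) (μ₀ : Measure (Ω × Ω)) [IsProbabilityMeasure μ₀] {g : Ω → ℝ} (hg : Measurable g) {a c : ℝ}
    (ha : ∀ x, a ≤ g x) (hc : ∀ x, g x ≤ c) :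
    ∫ p, |g p.1 - g p.2| ∂((fun m : Measure (Ω × Ω) => m.bind Khat)^[n] μ₀) ≤ (1 - (w x₀)⁻¹) ^ n * (c - a) := by
  obtain ⟨ν, hν, h⟩ := exists_iterate_bind_crnPair_eq_mixture hw hw0 hmax Khat hK n μ₀
  set π : Measure Ω := q.withDensity fun y => ENNReal.ofReal (w y) with hπ
  have hdiag : Measurable (fun y : Ω => (y, y)) := measurable_id.prodMk measurable_id
  have hW : 1 ≤ w x₀ := one_le_of_mode (q := q) hmax
  have hr0 : 0 ≤ 1 - (w x₀)⁻¹ := sub_nonneg.2 (inv_le_one_of_one_le₀ hW)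
  have hr1 : 1 - (w x₀)⁻¹ ≤ 1 := sub_le_self _ (inv_nonneg.mpr (hw0 x₀).le)
  have hc0 : 0 ≤ 1 - (1 - (w x₀)⁻¹) ^ n := sub_nonneg.2 (pow_le_one₀ hr0 hr1)
  have hFm : Measurable (fun p : Ω × Ω => |g p.1 - g p.2|) :=
    ((hg.comp measurable_fst).sub (hg.comp measurable_snd)).abs
  have hFb : ∀ p : Ω × Ω, |(fun p : Ω × Ω => |g p.1 - g p.2|) p| ≤ max |(0 : ℝ)| |c - a| := by
    intro p
    dsimp only
    have h1 := ha p.1; have h2 := hc p.1; have h3 := ha p.2; have h4 := hc p.2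
    exact abs_le_max_abs_abs (abs_nonneg _) (abs_le.2 ⟨by linarith, by linarith⟩)
  have hFi : ∀ (m : Measure (Ω × Ω)) [IsFiniteMeasure m], Integrable (fun p : Ω × Ω => |g p.1 - g p.2|) m :=
    fun m _ => Summit.Ventures.LatticeQCDFlow.Scoring.integrable_of_bounded m hFm hFb
  haveI : IsProbabilityMeasure (π.map (fun y : Ω => (y, y))) := isProbabilityMeasure_diagLift π
  rw [h, integral_add_measure ((hFi _).smul_measure ENNReal.ofReal_ne_top)
      ((hFi ν).smul_measure ENNReal.ofReal_ne_top),
    integral_smul_measure, integral_smul_measure, ENNReal.toReal_ofReal hc0,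
    ENNReal.toReal_ofReal (pow_nonneg hr0 n), smul_eq_mul, smul_eq_mul,
    integral_map hdiag.aemeasurable (hFm.aestronglyMeasurable)]
  simp only [sub_self, abs_zero, integral_zero, mul_zero, zero_add]
  have hνb : ∫ p, |g p.1 - g p.2| ∂ν ≤ c - a := by
    have := integral_mono (hFi ν) (integrable_const (c - a)) (fun p => by
      have h1 := ha p.1; have h2 := hc p.1; have h3 := ha p.2; have h4 := hc p.2
      exact abs_le.2 ⟨by linarith, by linarith⟩)
    rwa [integral_const, probReal_univ, one_smul] at this
  exact mul_le_mul_of_nonneg_left hνb (pow_nonneg hr0 n)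

/-! ## §4 The residual pair kernel also preserves the diagonal lift (appended 2026-08-29, GEN-36) -/

/-- **THE DIAGONAL LIFT IS INVARIANT FOR THE RESIDUAL PAIR KERNEL TOO**: `π̂R̂ = π̂` (`w(x₀) > 1`; `R̂` the residual
kernel of the pair minorisation `K̂ ≥ (1/w(x₀))·π̂`) — from `π̂K̂ = π̂` and the split `π̂K̂ = A·π̂ + (1 − A)·π̂R̂` by
cancellation (the pair analogue of GEN-34's `bind_residual_indepMH_target`). [ours] -/
theorem bind_residual_crnPair_diagLift (hw : Measurable w) (hw0 : ∀ y, 0 < w y) {x₀ : Ω} (hmax : ∀ y, w y ≤ w x₀)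
    (hlt : 1 < w x₀) [IsProbabilityMeasure (q.withDensity fun y => ENNReal.ofReal (w y))]
    (Khat : Kernel (Ω × Ω) (Ω × Ω)) [IsMarkovKernel Khat]
    (hK : ∀ z : Ω × Ω, Khat z = (q.prod (volume : Measure unitInterval)).map (fun p : Ω × unitInterval =>
      ((if (p.2 : ℝ) * w z.1 ≤ w p.1 then p.1 else z.1), (if (p.2 : ℝ) * w z.2 ≤ w p.1 then p.1 else z.2)))) :
    ((q.withDensity fun y => ENNReal.ofReal (w y)).map (fun y : Ω => (y, y))).bind
        (@Doeblin.residualKernel (Ω × Ω) _ Khat _ ((q.withDensity fun y => ENNReal.ofReal (w y)).map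
          (fun y : Ω => (y, y))) (isProbabilityMeasure_diagLift _) (ENNReal.ofReal (w x₀)⁻¹)
          (crnPair_minorised hw hw0 hmax Khat hK)) =
      (q.withDensity fun y => ENNReal.ofReal (w y)).map (fun y : Ω => (y, y)) := by
  set πh : Measure (Ω × Ω) := (q.withDensity fun y => ENNReal.ofReal (w y)).map (fun y : Ω => (y, y)) with hπh
  haveI hπhP : IsProbabilityMeasure πh := isProbabilityMeasure_diagLift _
  set ε : ℝ≥0∞ := ENNReal.ofReal (w x₀)⁻¹ with hε
  have hε1 : ε < 1 := ofReal_inv_lt_one_of_one_lt hlt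
  haveI := @Doeblin.isMarkovKernel_residualKernel (Ω × Ω) _ Khat _ πh hπhP ε
    (crnPair_minorised hw hw0 hmax Khat hK) hε1
  set R := @Doeblin.residualKernel (Ω × Ω) _ Khat _ πh hπhP ε (crnPair_minorised hw hw0 hmax Khat hK) with hR
  haveI : IsProbabilityMeasure (πh.bind R) :=
    ⟨by rw [Measure.bind_apply MeasurableSet.univ (Kernel.aemeasurable _)]; simp⟩
  have hinv : πh.bind Khat = πh := bind_diagLift_crnPair hw hw0 Khat hK
  have hsplit := Doeblin.bind_eq_add_residual (κ := Khat) (ν := πh) (ε := ε)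
    (hmin := crnPair_minorised hw hw0 hmax Khat hK) hε1 πh
  rw [hinv] at hsplit
  have h1e : 1 - ε ≠ 0 := (tsub_pos_of_lt hε1).ne'
  have h1t : 1 - ε ≠ ⊤ := ne_top_of_le_ne_top ENNReal.one_ne_top tsub_le_self
  ext B hB
  have h := congrArg (fun m : Measure (Ω × Ω) => m B) hsplit
  simp only [Measure.add_apply, Measure.smul_apply, smul_eq_mul] at h
  have hsum : ε * πh B + (1 - ε) * πh B = πh B := by
    rw [← add_mul, add_tsub_cancel_of_le hε1.le, one_mul]
  nth_rewrite 1 [← hsum] at h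
  have hεB : ε * πh B ≠ ⊤ := ENNReal.mul_ne_top ENNReal.ofReal_ne_top (measure_ne_top _ _)
  have h2 : (1 - ε) * πh B = (1 - ε) * (πh.bind R) B := (ENNReal.add_right_inj hεB).1 h
  exact ((ENNReal.mul_right_inj h1e h1t).1 h2).symm

end Summit.Ventures.LatticeQCDFlow.Exactness

end
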